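import Summits.QuantumFields.YangMills.Theorems.BalabanUVNodesN22KernelFadingOfStepRateTwoConstants
import Summits.QuantumFields.YangMills.Theorems.BalabanUVNodesN22WindowedCouplingHoloOfJointHolo

/-!
# BalabanUVNodes ∕ node N22 = NE9 — THE AGE-WEIGHTED ANALYTIC ROAD: `…N22KernelFadingOfStepRateTwoConstants` at ANY geometric growth `q ≥ θ` of the windowed coupling-chart
# bounds in the age of the updated coupling — rate `θ^{1−s}q^{s}`, which is `< 1` for SOME `s ∈ ]0,1[` WHATEVER `q` is: the analytic road's window does not shrink with the growth

WIDTH SEAT dag-n22-w1 (harness re-seat g5), piece C11 of its own lineage (C2 = `…N22KernelFadingOfStepRateTwoConstants`, p624657, g4).  Cell `pub-ymgap`, HUMAN RULING D-0062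
(Track A) ∕ D-0149; `--kind proof --supports stmt-QuantumFields-27366 --as helper` (K3⁸ `SpineGivenEndpointR13SepCoPHV`, KEY MAP v2), COUNT-NEUTRAL.  THEOREMS ONLY (0 `def`,
0 `sorry`, standard axioms).  Imports C2 and C3 (`JointHolo.exists_exponent_rpow_le`) only; §1–§3 are C2's texts with the growth letter threaded (dag-n22-a's `interp_geometric`
at `μ := q` instead of `μ := 1`); nothing re-declared.

WHY (dag-n22-c g16's door, pub-ymgap INBOX 2026-08-28 14:53Z, read on ROAD 3).  C2 §1 `ne9_and_fadingMemory_EA_of_kernelStepRate_windowedHolo` — and through it C4 §3, C6 §3, C8b,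
C9a∕b — displays the windowed coupling-holomorphy datum `hA` with ONE bound `B·e^{−κ|z|₁}` for EVERY young coupling `m ≤ k`: AGE-UNIFORM, exactly as J38 pinned `μ = 1` on the
second-difference road.  Producers of older-coupling regularity in the tree (dag-n22-a's second-order step recursion) deliver profiles GROWING geometrically in the age `k − m`.
dag-n22-a's module 10 (`N22KnitTwoConstants.ne9_and_fadingMemory_of_osc_analytic_rpow`, `interp_geometric`) already carries a growth letter `μ ≥ θ` with rate `τ_s = θ^{1−s}μ^{s}`;
THIS FILE threads it through the kernel-record road: `hA` with `B·q^{k−m}·e^{−κ|z|₁}` ⟹ `NE9 ∧ FadingMemory` at rate `θ^{1−s}q^{s}`.  THE POINT (§4): for EVERY growth `q ≥ θ₅`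
and EVERY fading rate `ω ∈ ]θ₅, 1[` there is `s ∈ ]0,1[` with `θ₅^{1−s}q^{s} ≤ ω` — the analytic road tolerates ARBITRARY geometric growth of the chart bounds (the price is the
constant `C₉ ~ s⁻²`), whereas the second-difference road's age-weighted edition (dag-n22-c J48 §4) books `θ₅·q ≤ ω² < 1`, i.e. `q < θ₅⁻¹`.

WHAT (all [folklore]).  §1 ★ `eventually_windowedNE9Bound_of_kernelFlat_growing` (C2's telescoped windowed letter with `hA`'s bound `B·q^{k−m}·e^{−κ|z|₁}`, `θ ≤ q`, `C₀ ≤ B`; rate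
`θ^{1−s}q^{s}`).  §2 ★★ `ne9_and_fadingMemory_EA_of_kernelStepRate_windowedHoloGrowing` (N18's `KernelStepRate` + `DecayBound` + (1.21) + the GROWING datum ⟹
`NE9 (EA F ℰ ρ bV) (Window γ) κ Λ ∧ FadingMemory C₉ (θ^{1−s}q^{s}) Λ`, every `s ∈ ]0,1[`; C2 §1 is `q = 1`).  §3 ★★★ `ne9_EA_objectsOfRecord₁₃_of_kernelStepRate_windowedHoloGrowing`
(K3 §2b's `h9` with the record's geometric moduli under the rows `ℓ.θ₅ ≤ q`, `0 < s < 1`, `ℓ.θ₅^{1−s}·q^{s} ≤ ℓ.ω`, `ℓ.κ ≤ κ`, `C₉(s,q) ≤ ℓ.C₉`) and its pin face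
`n22At_rateCarriers_of_kernels_pin_of_kernelStepRate_windowedHoloGrowing`.  §4 ★ `exists_exponent_rpow_mul_rpow_le` (`0 < θ ≤ q`, `θ < ω < 1` ⟹ `∃ s ∈ ]0,1[`, `θ^{1−s}q^{s} ≤ ω`)
and ★ `exists_letterBlock_rows_twoConstantsGrowing` (§3's rows are JOINTLY SATISFIABLE with `ℓ.Signs` for EVERY `q ≥ θ₅` and EVERY `ω ∈ ]θ₅, 1[`).

HONEST FRAMING (binding).  Hypothesis-form GENERALIZATION (count-neutral helper): N18's kernel step rate (NE5 NOT PRINTED for d = 4), the uniform decay, (1.21) and the growing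
windowed datum are BINDERS met by no object of record here; nothing of Bałaban's asserted or constructed ([I] = CMP 109 (1987) p. 263, (1.18)–(1.21) p. 264, §2 p. 266; [II] =
CMP 116 (1988) (2.13)–(2.14) pp. 14–15 — TYPES only); N22 NOT discharged (typed 28∕28 · discharged 5∕27 UNCHANGED — the chair's single count line is the only count); K3⁸ OPEN,
NOT claimed, no stub touched; one finite 𝕋⁴ programme at fixed ε — R4 closes the CONDITIONAL rung `BalabanLadder.UV` only; NOTHING about the continuum limit, ℝ⁴, OS axioms, a
mass gap or the Clay problem is proved or claimed by any of this.
-/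

noncomputable section

open Filter Topology Set Metric
open scoped BigOperators

namespace YMDAG.N22.KernelFadingTwoConstants

open Literature.MathematicalPhysics.QuantumFieldTheory.Balaban1983to89
open Literature.MathematicalPhysics.QuantumFieldTheory.Balaban1983to89.T4Continuum (T4Family ULoop)
open Literature.MathematicalPhysics.QuantumFieldTheory.Balaban1983to89.T4OutputRate (Carriers Functional Window NE9 FadingMemory DecayBound PrefixDependenceOn)
open Literature.MathematicalPhysics.QuantumFieldTheory.Balaban1983to89.Node00 (TermFamily1 polWindow polLimit PolLimitExists tendsto_polLimit mergedTermFamilyMatT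
  TβOfRecord₁₃ chiβOfRecord₁₃ Stage13Params Stage13HParams MatA U3Letters₁₁)
open Literature.MathematicalPhysics.QuantumFieldTheory.Balaban1983to89.Node00.U3OfKernels (carriers pt histPrefix kernelA EA objectsOfRecord₁₃ kernelA_eq kernelA_congr
  EA_apply)
open Literature.MathematicalPhysics.QuantumFieldTheory.Balaban1983to89.Node00.U3KernelLetters (KernelStepRate KernelStepRateOfRecord₁₃ PolLimitsExistOfRecord₁₃)
open Literature.MathematicalPhysics.QuantumFieldTheory.Balaban1983to89.B12Sec2to5 (l1 l1_nonneg)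
open YMDAG.UVSplit (N22At RateReading₁₃CoPH rateCarriersOfRecord₁₃CoPH)
open YMDAG.N22.AtKernels (ne9_EA_of_windowed n22At_rateCarriers_of_kernels_pin_of_ne9)
open YMDAG.N22.KernelFading (ne9_mono osc_EA_of_kernelStepRate_decayBound update_mem_window)
open Literature.MathematicalPhysics.QuantumFieldTheory.Balaban1983to89.T4CouplingAnalyticity (hybrid hybrid_zero hybrid_succ update_hybrid_self hybrid_mem_window hybrid_apply_lt)
open Summit.QuantumFields.YangMills.BalabanUVNodes.N22KnitTwoConstants (interp_geometric)
open Summit.QuantumFields.YangMills.BalabanUVNodes.N22Knit (fadingMemory_geometric)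
open YMDAG.N22.JointHolo (exists_exponent_rpow_le)

open scoped Matrix.Norms.L2Operator

/-! ## §1–§2 Generic term family `ℰ`: the telescoped windowed letter and NE9 ∧ fading memory at the GROWING datum -/

section Generic

variable (F : T4Family) {𝔄 : Type*} [NormedRing 𝔄] [NormedAlgebra ℝ 𝔄] {V : Type*} [NormedAddCommGroup V] [NormedSpace ℝ V] {ι' : Type*} [Fintype ι']
  (ℰ : TermFamily1 F 𝔄) (ρ : V →L[ℝ] 𝔄) (bV : Module.Basis ι' ℝ V)

/-- ★ **THE TELESCOPED WINDOWED LETTER AT A GROWING DATUM**: as C2's `eventually_windowedNE9Bound_of_kernelFlat`, with the windowed holomorphy datum carrying the bound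
`B·q^{k−m}·e^{−κ|z|₁}` in the young coupling `m` (growth ratio `q ≥ θ`): eventually `|Π^{(K)}_{k+1}(g; z) − Π^{(K)}_{k+1}(g'; z)| ≤ e^{−κ|z|₁}Σ_{m<k+1} C₉τ^{k+1−m}|g_m − g'_m|`,
`τ = θ^{1−s}q^{s}`, `C₉ = (32∕(s²r₁))(2C₀)^{1−s}(2B)^{s}∕τ` (`interp_geometric` at `μ := q`). [folklore] -/
theorem eventually_windowedNE9Bound_of_kernelFlat_growing {γ κ θ q r B C₀ s : ℝ} (hγ : 0 < γ) (hr : 0 < r) (hθ0 : 0 < θ) (hθq : θ ≤ q)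
    (hC₀ : 0 < C₀) (hCB : C₀ ≤ B) (hs0 : 0 < s) (hs1 : s < 1)
    (hflat : ∀ h ∈ Window γ, ∀ (k : ℕ) (μ ν : Fin 4) (z : Fin 4 → ℤ) (m : ℕ), m < k + 1 → ∀ x ∈ Ioc (0 : ℝ) γ, ∀ y ∈ Ioc (0 : ℝ) γ,
      |kernelA F ℰ ρ bV (Function.update h m x) k μ ν z - kernelA F ℰ ρ bV (Function.update h m y) k μ ν z| ≤
        C₀ * θ ^ (k - m) * Real.exp (-(κ * l1 z)))
    (hlim : ∀ g ∈ Window γ, ∀ k : ℕ, PolLimitExists F (k + 1) (fun K => ℰ k (histPrefix g k) K) ρ bV)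
    (hA : ∀ h ∈ Window γ, ∀ (k : ℕ) (μ ν : Fin 4) (z : Fin 4 → ℤ) (m : ℕ), m < k + 1 → ∀ᶠ K in atTop,
      ∃ (Fc : ℂ → ℂ) (D : Set ℂ), DifferentiableOn ℂ Fc D ∧ (∀ w ∈ D, ‖Fc w‖ ≤ B * q ^ (k - m) * Real.exp (-(κ * l1 z))) ∧
        (∀ t ∈ Ioc (0 : ℝ) γ, closedBall (t : ℂ) r ⊆ D) ∧
        (∀ t ∈ Ioc (0 : ℝ) γ, Fc t = (polWindow F K (k + 1) (ℰ k (histPrefix (Function.update h m t) k) K) ρ bV μ ν z : ℂ)))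
    {g g' : ℕ → ℝ} (hg : g ∈ Window γ) (hg' : g' ∈ Window γ) (k : ℕ) (μ ν : Fin 4) (z : Fin 4 → ℤ) :
    ∀ᶠ K in atTop,
      |polWindow F K (k + 1) (ℰ k (histPrefix g k) K) ρ bV μ ν z - polWindow F K (k + 1) (ℰ k (histPrefix g' k) K) ρ bV μ ν z| ≤
        Real.exp (-(κ * l1 z)) * ∑ m ∈ Finset.range (k + 1),
          32 / (s ^ 2 * min (r / 2) (γ / 2)) * ((2 * C₀) ^ (1 - s) * (2 * B) ^ s) / (θ ^ (1 - s) * q ^ s) *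
            (θ ^ (1 - s) * q ^ s) ^ (k + 1 - m) * |g m - g' m| := by
  set w : ℝ := Real.exp (-(κ * l1 z)) with hw
  have hw0 : 0 < w := Real.exp_pos _
  have hq0 : 0 < q := hθ0.trans_le hθq
  set τ : ℝ := θ ^ (1 - s) * q ^ s with hτ
  have hτ0 : 0 < τ := mul_pos (Real.rpow_pos_of_pos hθ0 _) (Real.rpow_pos_of_pos hq0 _)
  set c : ℝ := 32 / (s ^ 2 * min (r / 2) (γ / 2)) * ((2 * C₀) ^ (1 - s) * (2 * B) ^ s) with hc
  set W : ℕ → (ℕ → ℝ) → ℝ := fun K h => polWindow F K (k + 1) (ℰ k (histPrefix h k) K) ρ bV μ ν z with hW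
  set hyb : ℕ → ℕ → ℝ := fun m => hybrid g g' m with hhyb
  have hhybW : ∀ m, hyb m ∈ Window γ := fun m => hybrid_mem_window hg hg' m
  -- the one-coupling step along the hybrids, with the interpolated constant
  have hstep : ∀ m, m < k + 1 → ∀ᶠ K in atTop, |W K (hyb m) - W K (hyb (m + 1))| ≤ w * (c * τ ^ (k - m)) * |g m - g' m| := by
    intro m hm
    have hB : 0 < B := hC₀.trans_le hCB
    have hεB : C₀ * θ ^ (k - m) ≤ B * q ^ (k - m) := mul_le_mul hCB (pow_le_pow_left₀ hθ0.le hθq _) (pow_nonneg hθ0.le _) (hC₀.le.trans hCB)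
    have h1 := eventually_windowedCoordLetter_of_kernelFlat F ℰ ρ bV hγ hr (by positivity) hεB hs0 hs1 (hyb m) m k μ ν z
      (hflat (hyb m) (hhybW m) k μ ν z m hm) (fun t ht => hlim _ (update_mem_window (hhybW m) m ht) k)
      (hA (hyb m) (hhybW m) k μ ν z m hm)
    filter_upwards [h1] with K hK
    have h2 := hK (g m) ⟨(hg m).1, (hg m).2⟩ (g' m) ⟨(hg' m).1, (hg' m).2⟩
    have e1 : Function.update (hyb m) m (g m) = hyb m := update_hybrid_self g g' m
    have e2 : Function.update (hyb m) m (g' m) = hyb (m + 1) := (hybrid_succ g g' m).symm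
    rw [e1, e2] at h2
    have e3 : 32 / (s ^ 2 * min (r / 2) (γ / 2)) * (2 * (C₀ * θ ^ (k - m) * w)) ^ (1 - s) * (2 * (B * q ^ (k - m) * w)) ^ s
        = w * (c * τ ^ (k - m)) := by
      rw [show 2 * (C₀ * θ ^ (k - m) * w) = 2 * C₀ * θ ^ (k - m) * w by ring,
        show 2 * (B * q ^ (k - m) * w) = 2 * B * q ^ (k - m) * w by ring, mul_assoc,
        interp_geometric (by positivity : (0 : ℝ) < 2 * C₀) hB hθ0 hq0 hw0 (k - m), hc, hτ]
      ring
    rw [e3] at h2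
    exact h2
  -- telescoping: eventually, `|W g − W (hyb m)| ≤ w Σ_{j<m} c τ^{k−j} |g j − g' j|`
  have htel : ∀ m, m ≤ k + 1 → ∀ᶠ K in atTop, |W K g - W K (hyb m)| ≤ w * ∑ j ∈ Finset.range m, c * τ ^ (k - j) * |g j - g' j| := by
    intro m
    induction m with
    | zero =>
      intro _
      refine Eventually.of_forall fun K => ?_
      have e : hyb 0 = g := hybrid_zero g g'
      rw [e, sub_self, abs_zero, Finset.sum_range_zero, mul_zero]
    | succ m ih =>
      intro hm
      filter_upwards [ih (by omega), hstep m (by omega)] with K h1 h2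
      rw [Finset.sum_range_succ, mul_add]
      calc |W K g - W K (hyb (m + 1))| = |(W K g - W K (hyb m)) + (W K (hyb m) - W K (hyb (m + 1)))| := by ring_nf
        _ ≤ |W K g - W K (hyb m)| + |W K (hyb m) - W K (hyb (m + 1))| := abs_add_le _ _
        _ ≤ w * ∑ j ∈ Finset.range m, c * τ ^ (k - j) * |g j - g' j| + w * (c * τ ^ (k - m)) * |g m - g' m| := add_le_add h1 h2
        _ = w * ∑ j ∈ Finset.range m, c * τ ^ (k - j) * |g j - g' j| + w * (c * τ ^ (k - m) * |g m - g' m|) := by ring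
  have hlast : ∀ K, W K (hyb (k + 1)) = W K g' := fun K =>
    polWindow_congr_of_agree F ℰ ρ bV (fun i hi => hybrid_apply_lt g g' hi) K μ ν z
  filter_upwards [htel (k + 1) le_rfl] with K hK
  rw [hlast K] at hK
  refine hK.trans (le_of_eq ?_)
  congr 1
  refine Finset.sum_congr rfl fun m hm => ?_
  have hmk : m ≤ k := Nat.lt_succ_iff.mp (Finset.mem_range.mp hm)
  rw [show k + 1 - m = (k - m) + 1 by omega, pow_succ]
  field_simp


/-- ★★ **NE9 ∧ FADING MEMORY OF THE KERNEL FUNCTIONAL AT THE GROWING DATUM, RATE `θ^{1−s}q^{s}`.**  As C2's `ne9_and_fadingMemory_EA_of_kernelStepRate_windowedHolo`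
(N18's `KernelStepRate` + `DecayBound` + (1.21) + the windowed coupling-holomorphy datum), with the datum's bound GROWING like `B·q^{k−m}` in the age of the updated coupling
(`θ ≤ q`): for EVERY `s ∈ ]0,1[`, `NE9 (EA F ℰ ρ bV) (Window γ) κ Λ ∧ FadingMemory C₉ (θ^{1−s}q^{s}) Λ`, `Λ k i = C₉(θ^{1−s}q^{s})^{k−i}`,
`C₉ = (32∕(s²·min(r∕2,γ∕2)))(2C₀)^{1−s}(2B)^{s}∕(θ^{1−s}q^{s})`, `C₀ = 2C₅∕(1−θ) + 2E₀` — C2 §1 is `q = 1`. [folklore] -/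
theorem ne9_and_fadingMemory_EA_of_kernelStepRate_windowedHoloGrowing {γ κ θ q C₅ E₀ B r s : ℝ}
    (hC₅ : 0 ≤ C₅) (hθ0 : 0 < θ) (hθ1 : θ < 1) (hθq : θ ≤ q) (hE₀ : 0 < E₀) (hγ : 0 < γ) (hr : 0 < r) (hs0 : 0 < s) (hs1 : s < 1)
    (h5 : KernelStepRate F ℰ ρ bV γ κ θ C₅) (hdec : DecayBound (EA F ℰ ρ bV) (Window γ) E₀ κ)
    (hCB : 2 * C₅ / (1 - θ) + 2 * E₀ ≤ B)
    (hlim : ∀ g ∈ Window γ, ∀ k : ℕ, PolLimitExists F (k + 1) (fun K => ℰ k (histPrefix g k) K) ρ bV)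
    (hA : ∀ h ∈ Window γ, ∀ (k : ℕ) (μ ν : Fin 4) (z : Fin 4 → ℤ) (m : ℕ), m < k + 1 → ∀ᶠ K in atTop,
      ∃ (Fc : ℂ → ℂ) (D : Set ℂ), DifferentiableOn ℂ Fc D ∧ (∀ w ∈ D, ‖Fc w‖ ≤ B * q ^ (k - m) * Real.exp (-(κ * l1 z))) ∧
        (∀ t ∈ Ioc (0 : ℝ) γ, closedBall (t : ℂ) r ⊆ D) ∧
        (∀ t ∈ Ioc (0 : ℝ) γ, Fc t = (polWindow F K (k + 1) (ℰ k (histPrefix (Function.update h m t) k) K) ρ bV μ ν z : ℂ))) :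
    NE9 (EA F ℰ ρ bV) (Window γ) κ
        (fun k i => 32 / (s ^ 2 * min (r / 2) (γ / 2)) * ((2 * (2 * C₅ / (1 - θ) + 2 * E₀)) ^ (1 - s) * (2 * B) ^ s) / (θ ^ (1 - s) * q ^ s) *
          (θ ^ (1 - s) * q ^ s) ^ (k - i)) ∧
      FadingMemory (32 / (s ^ 2 * min (r / 2) (γ / 2)) * ((2 * (2 * C₅ / (1 - θ) + 2 * E₀)) ^ (1 - s) * (2 * B) ^ s) / (θ ^ (1 - s) * q ^ s))
        (θ ^ (1 - s) * q ^ s)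
        (fun k i => 32 / (s ^ 2 * min (r / 2) (γ / 2)) * ((2 * (2 * C₅ / (1 - θ) + 2 * E₀)) ^ (1 - s) * (2 * B) ^ s) / (θ ^ (1 - s) * q ^ s) *
          (θ ^ (1 - s) * q ^ s) ^ (k - i)) := by
  have h1θ : 0 < 1 - θ := by linarith
  have hC₀ : 0 < 2 * C₅ / (1 - θ) + 2 * E₀ := by positivity
  have hτ0 : 0 < θ ^ (1 - s) * q ^ s := mul_pos (Real.rpow_pos_of_pos hθ0 _) (Real.rpow_pos_of_pos (hθ0.trans_le hθq) _)
  -- the kernel oscillation letter between one-coupling updates (J38 §1)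
  have hosc := osc_EA_of_kernelStepRate_decayBound F ℰ ρ bV hC₅ hθ0.le hθ1 hE₀.le h5 hdec
  have hflat : ∀ h ∈ Window γ, ∀ (k : ℕ) (μ ν : Fin 4) (z : Fin 4 → ℤ) (m : ℕ), m < k + 1 → ∀ x ∈ Ioc (0 : ℝ) γ, ∀ y ∈ Ioc (0 : ℝ) γ,
      |kernelA F ℰ ρ bV (Function.update h m x) k μ ν z - kernelA F ℰ ρ bV (Function.update h m y) k μ ν z| ≤
        (2 * C₅ / (1 - θ) + 2 * E₀) * θ ^ (k - m) * Real.exp (-(κ * l1 z)) := by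
    intro h hh k μ ν z m hm x hx y hy
    have hagree : ∀ n, m + 1 ≤ n → Function.update h m x n = Function.update h m y n := fun n hn => by
      have hnm : n ≠ m := by omega
      rw [Function.update_of_ne hnm, Function.update_of_ne hnm]
    have h1 := hosc _ (update_mem_window hh m hx) _ (update_mem_window hh m hy) PUnit.unit (k, μ, ν, z) (m + 1) (by exact hm) hagree
    rw [EA_apply, EA_apply] at h1
    simpa [show k + 1 - (m + 1) = k - m by omega] using h1
  refine ⟨ne9_EA_of_windowed F ℰ ρ bV hlim fun g hg g' hg' k μ ν z => ?_, ?_⟩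
  · exact eventually_windowedNE9Bound_of_kernelFlat_growing F ℰ ρ bV hγ hr hθ0 hθq hC₀ hCB hs0 hs1 hflat hlim hA hg hg' k μ ν z
  · refine fadingMemory_geometric ?_ hτ0.le
    have h1 : 0 ≤ (2 * (2 * C₅ / (1 - θ) + 2 * E₀)) ^ (1 - s) := Real.rpow_nonneg (by positivity) _
    have h2 : 0 ≤ (2 * B) ^ s := Real.rpow_nonneg (by linarith [hC₀.le.trans hCB]) _
    have h3 : 0 < min (r / 2) (γ / 2) := lt_min (by linarith) (by linarith)
    positivity


end Generic

/-! ## §3 AT THE RECORD: K3 §2b's `h9` with the record's GEOMETRIC moduli on the age-weighted analytic road, and the N22 pin face -/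

section Record

variable (F : T4Family) (N : ℕ) [NeZero N]

/-- ★★★ **K3 §2b's `h9` WITH THE RECORD's MODULI ON THE AGE-WEIGHTED ANALYTIC ROAD** (growth `q ≥ ℓ.θ₅` of the windowed chart bounds; C2 §2 is `q = 1`): at a Stage-13 tuple `θ` (`0 < θ.γ`) and a letter block `ℓ` with its signs,
`KernelStepRateOfRecord₁₃ F N θ κ ℓ.θ₅ C₅` + `DecayBound ((objectsOfRecord₁₃ F N θ ℓ).EA 0) (Window θ.γ) E₀ κ` (`E₀ > 0`) + `PolLimitsExistOfRecord₁₃ F N θ` + the WINDOWED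
coupling-holomorphy datum of the merged term family of record (uniform `B ≥ 2C₅∕(1−ℓ.θ₅) + 2E₀`, `r > 0`; DISPLAYED) + the LETTER ROWS `0 < s < 1`, `ℓ.θ₅^{1−s} ≤ ℓ.ω`,
`ℓ.κ ≤ κ`, `C₉(s) ≤ ℓ.C₉` ⟹ **`NE9 ((objectsOfRecord₁₃ F N θ ℓ).EA 0) (Window θ.γ) ℓ.κ ℓ.moduli`** (§1 + `ne9_mono`); rows satisfiable with `ℓ.Signs` for EVERY
`ℓ.ω ∈ ]ℓ.θ₅, 1[` — versus J38's `ℓ.θ₅ ≤ ℓ.ω²`.  LOCATED; N22 NOT discharged. [folklore] -/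
theorem ne9_EA_objectsOfRecord₁₃_of_kernelStepRate_windowedHoloGrowing (θ : Stage13Params F N) (ℓ : U3Letters₁₁) (hs : ℓ.Signs) (hγ : 0 < θ.γ)
    {κ C₅ E₀ B r s q : ℝ} (hC₅ : 0 ≤ C₅) (hE₀ : 0 < E₀) (hr : 0 < r) (hs0 : 0 < s) (hs1 : s < 1) (hq : ℓ.θ₅ ≤ q)
    (h5 : KernelStepRateOfRecord₁₃ F N θ κ ℓ.θ₅ C₅)
    (hdec : DecayBound ((objectsOfRecord₁₃ F N θ ℓ).EA 0) (Window θ.γ) E₀ κ)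
    (hCB : 2 * C₅ / (1 - ℓ.θ₅) + 2 * E₀ ≤ B)
    (hlim : PolLimitsExistOfRecord₁₃ F N θ)
    (hA : letI := θ.instVβ₁; letI := θ.instVβ₂; letI := θ.instιβ
      ∀ h ∈ Window θ.γ, ∀ (k : ℕ) (μ ν : Fin 4) (z : Fin 4 → ℤ) (m : ℕ), m < k + 1 → ∀ᶠ K in atTop,
        ∃ (Fc : ℂ → ℂ) (D : Set ℂ), DifferentiableOn ℂ Fc D ∧ (∀ w ∈ D, ‖Fc w‖ ≤ B * q ^ (k - m) * Real.exp (-(κ * l1 z))) ∧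
          (∀ t ∈ Ioc (0 : ℝ) θ.γ, closedBall (t : ℂ) r ⊆ D) ∧
          (∀ t ∈ Ioc (0 : ℝ) θ.γ, Fc t = (polWindow F K (k + 1)
            (mergedTermFamilyMatT F N (TβOfRecord₁₃ F N) (chiβOfRecord₁₃ F N θ) θ.εbg k (histPrefix (Function.update h m t) k) K) θ.ρ8 θ.bV μ ν z : ℂ)))
    (hτω : ℓ.θ₅ ^ (1 - s) * q ^ s ≤ ℓ.ω) (hκ : ℓ.κ ≤ κ)
    (hC₉ : 32 / (s ^ 2 * min (r / 2) (θ.γ / 2)) * ((2 * (2 * C₅ / (1 - ℓ.θ₅) + 2 * E₀)) ^ (1 - s) * (2 * B) ^ s) / (ℓ.θ₅ ^ (1 - s) * q ^ s) ≤ ℓ.C₉) :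
    NE9 ((objectsOfRecord₁₃ F N θ ℓ).EA 0) (Window θ.γ) ℓ.κ ℓ.moduli := by
  letI := θ.instVβ₁; letI := θ.instVβ₂; letI := θ.instιβ
  have h := ne9_and_fadingMemory_EA_of_kernelStepRate_windowedHoloGrowing F
    (mergedTermFamilyMatT F N (TβOfRecord₁₃ F N) (chiβOfRecord₁₃ F N θ) θ.εbg) θ.ρ8 θ.bV hC₅ hs.θ₅_pos hs.θ₅_lt_one hq hE₀ hγ hr hs0 hs1 h5 hdec hCB
    hlim hA
  have hτ0 : 0 ≤ ℓ.θ₅ ^ (1 - s) * q ^ s := mul_nonneg (Real.rpow_nonneg hs.θ₅_pos.le _) (Real.rpow_nonneg (hs.θ₅_pos.le.trans hq) _)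
  have hC90 : 0 ≤ 32 / (s ^ 2 * min (r / 2) (θ.γ / 2)) * ((2 * (2 * C₅ / (1 - ℓ.θ₅) + 2 * E₀)) ^ (1 - s) * (2 * B) ^ s) / (ℓ.θ₅ ^ (1 - s) * q ^ s) :=
    (h.2 0 0 le_rfl).1.trans_eq (by simp)
  refine ne9_mono h.1 hκ (fun k i => ?_) (hs.moduli_nonneg)
  rw [U3Letters₁₁.moduli_apply]
  exact mul_le_mul hC₉ (pow_le_pow_left₀ hτ0 hτω _) (pow_nonneg hτ0 _) hs.C₉_nonneg

open Classical in
/-- ★★★ **THE N22 PIN FACE ON THE AGE-WEIGHTED ANALYTIC ROAD**: under K3⁷ v5's node-U3 pin (`hpin`) the inputs above give `N22At (rateCarriersOfRecord₁₃CoPH 𝔯 F θ hP g₀ os k).u3` for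
EVERY run length `k` (dag-n22-w3's junction BY NAME): «N18's kernel step rate + uniform decay + (1.21) + windowed coupling holomorphy on uniform margins + rows (`ℓ.ω`
ANYWHERE in `]ℓ.θ₅, 1[`) ⇒ v5 §2b `h9` ∕ `N22At` at the pinned bundle».  LOCATED; N22 NOT discharged. [folklore] -/
theorem n22At_rateCarriers_of_kernels_pin_of_kernelStepRate_windowedHoloGrowing (𝔯 : RateReading₁₃CoPH N) (θ : Stage13HParams F N) (hP : θ.Provisos₁₃CoPH F N)
    (g₀ : ℕ → ℝ) (os : List (ULoop F)) (ℓ : U3Letters₁₁) (hs : ℓ.Signs) (hγ : 0 < θ.γ)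
    (hpin : (𝔯.lit F θ hP g₀ os).u3 = objectsOfRecord₁₃ F N θ.toStage13Params ℓ)
    {κ C₅ E₀ B r s q : ℝ} (hC₅ : 0 ≤ C₅) (hE₀ : 0 < E₀) (hr : 0 < r) (hs0 : 0 < s) (hs1 : s < 1) (hq : ℓ.θ₅ ≤ q)
    (h5 : KernelStepRateOfRecord₁₃ F N θ.toStage13Params κ ℓ.θ₅ C₅)
    (hdec : DecayBound ((objectsOfRecord₁₃ F N θ.toStage13Params ℓ).EA 0) (Window θ.γ) E₀ κ)
    (hCB : 2 * C₅ / (1 - ℓ.θ₅) + 2 * E₀ ≤ B)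
    (hlim : PolLimitsExistOfRecord₁₃ F N θ.toStage13Params)
    (hA : letI := θ.instVβ₁; letI := θ.instVβ₂; letI := θ.instιβ
      ∀ h ∈ Window θ.γ, ∀ (k : ℕ) (μ ν : Fin 4) (z : Fin 4 → ℤ) (m : ℕ), m < k + 1 → ∀ᶠ K in atTop,
        ∃ (Fc : ℂ → ℂ) (D : Set ℂ), DifferentiableOn ℂ Fc D ∧ (∀ w ∈ D, ‖Fc w‖ ≤ B * q ^ (k - m) * Real.exp (-(κ * l1 z))) ∧
          (∀ t ∈ Ioc (0 : ℝ) θ.γ, closedBall (t : ℂ) r ⊆ D) ∧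
          (∀ t ∈ Ioc (0 : ℝ) θ.γ, Fc t = (polWindow F K (k + 1)
            (mergedTermFamilyMatT F N (TβOfRecord₁₃ F N) (chiβOfRecord₁₃ F N θ.toStage13Params) θ.εbg k (histPrefix (Function.update h m t) k) K)
              θ.ρ8 θ.bV μ ν z : ℂ)))
    (hτω : ℓ.θ₅ ^ (1 - s) * q ^ s ≤ ℓ.ω) (hκ : ℓ.κ ≤ κ)
    (hC₉ : 32 / (s ^ 2 * min (r / 2) (θ.γ / 2)) * ((2 * (2 * C₅ / (1 - ℓ.θ₅) + 2 * E₀)) ^ (1 - s) * (2 * B) ^ s) / (ℓ.θ₅ ^ (1 - s) * q ^ s) ≤ ℓ.C₉)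
    (k : ℕ) :
    N22At (rateCarriersOfRecord₁₃CoPH 𝔯 F θ hP g₀ os k).u3 :=
  n22At_rateCarriers_of_kernels_pin_of_ne9 𝔯 θ hP g₀ os ℓ hs hpin
    (ne9_EA_objectsOfRecord₁₃_of_kernelStepRate_windowedHoloGrowing F N θ.toStage13Params ℓ hs hγ hC₅ hE₀ hr hs0 hs1 hq h5 hdec hCB hlim hA hτω hκ hC₉) k

end Record

/-! ## §4 THE ROWS: the age-weighted analytic road's window does NOT shrink with the growth ratio -/

section Rows

/-- ★ **ANY GROWTH IS ADMISSIBLE**: for `0 < θ ≤ q` and `θ < ω < 1` there is `s ∈ ]0, 1[` with `θ^{1−s}·q^{s} ≤ ω` — `θ^{1−s}q^{s} = θ·e^{s·log(q∕θ)}`, take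
`s = min ½ (log(ω∕θ)∕(log(q∕θ) + 1))`. [folklore] -/
theorem exists_exponent_rpow_mul_rpow_le {θ q ω : ℝ} (hθ0 : 0 < θ) (hθq : θ ≤ q) (hθω : θ < ω) (hω1 : ω < 1) :
    ∃ s : ℝ, 0 < s ∧ s < 1 ∧ θ ^ (1 - s) * q ^ s ≤ ω := by
  have hq0 : 0 < q := hθ0.trans_le hθq
  have hω0 : 0 < ω := hθ0.trans hθω
  set L : ℝ := Real.log (q / θ) with hL
  set D : ℝ := Real.log (ω / θ) with hD
  have hL0 : 0 ≤ L := Real.log_nonneg ((one_le_div hθ0).2 hθq)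
  have hD0 : 0 < D := Real.log_pos ((one_lt_div hθ0).2 hθω)
  refine ⟨min (1 / 2) (D / (L + 1)), lt_min one_half_pos (div_pos hD0 (by linarith)), (min_le_left _ _).trans_lt (by norm_num), ?_⟩
  set s : ℝ := min (1 / 2) (D / (L + 1)) with hs
  have hsL : s * L ≤ D := by
    calc s * L ≤ D / (L + 1) * L := mul_le_mul_of_nonneg_right (min_le_right _ _) hL0
      _ ≤ D / (L + 1) * (L + 1) := mul_le_mul_of_nonneg_left (by linarith) (div_nonneg hD0.le (by linarith))
      _ = D := by field_simp
  have hkey : θ ^ (1 - s) * q ^ s = θ * Real.exp (s * L) := by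
    rw [Real.rpow_sub hθ0, Real.rpow_one, hL, ← Real.log_rpow (div_pos hq0 hθ0), Real.exp_log (Real.rpow_pos_of_pos (div_pos hq0 hθ0) _),
      Real.div_rpow hq0.le hθ0.le]
    field_simp
  rw [hkey]
  calc θ * Real.exp (s * L) ≤ θ * Real.exp D := mul_le_mul_of_nonneg_left (Real.exp_le_exp.2 hsL) hθ0.le
    _ = ω := by rw [hD, Real.exp_log (div_pos hω0 hθ0)]; field_simp

/-- ★ **THE ROWS OF §3 ARE JOINTLY SATISFIABLE WITH `ℓ.Signs` FOR EVERY GROWTH `q ≥ θ₅` AND EVERY RATE `ω ∈ ]θ₅, 1[`** (any right-hand side `f s` for the `C₉` row): the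
analytic road's window `θ₅ < ω` does NOT shrink with `q` (dag-n22-c J48 §4's second-difference road books `θ₅·q ≤ ω²`). [folklore] -/
theorem exists_letterBlock_rows_twoConstantsGrowing {θ₅ q ω C₅ κ : ℝ} (hθ0 : 0 < θ₅) (hθq : θ₅ ≤ q) (hθω : θ₅ < ω) (hω1 : ω < 1) (hC₅ : 0 ≤ C₅) (hκ : 0 ≤ κ)
    (f : ℝ → ℝ) :
    ∃ (s : ℝ) (ℓ : U3Letters₁₁), ℓ.Signs ∧ ℓ.θ₅ = θ₅ ∧ ℓ.C₅ = C₅ ∧ ℓ.ω = ω ∧ ℓ.θ₅ ≤ q ∧ 0 < s ∧ s < 1 ∧ ℓ.θ₅ ^ (1 - s) * q ^ s ≤ ℓ.ω ∧ ℓ.κ ≤ κ ∧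
      f s ≤ ℓ.C₉ := by
  obtain ⟨s, hs0, hs1, hse⟩ := exists_exponent_rpow_mul_rpow_le hθ0 hθq hθω hω1
  have hω0 : 0 ≤ ω := (hθ0.trans hθω).le
  refine ⟨s, { κ := 0, θ₅ := θ₅, C₅ := C₅, C₉ := max (f s) 0, ω := ω, cr := 0, ρ := ω }, ?_, rfl, rfl, rfl, hθq, hs0, hs1, hse, hκ, le_max_left _ _⟩
  exact { κ_nonneg := le_rfl, θ₅_pos := hθ0, θ₅_lt_one := hθω.trans hω1, C₅_nonneg := hC₅, C₉_nonneg := le_max_right _ _, ω_nonneg := hω0, ω_lt_one := hω1,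
          cr_nonneg := le_rfl, θ₅_le_ρ := hθω.le, ω_le_ρ := le_rfl, ρ_lt_one := hω1 }

end Rows

end YMDAG.N22.KernelFadingTwoConstants

end
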